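import Mathlib
import HarnessLib

/-!
# Real analysis of line `SketchIdeator2` (series-law-at-every-laplace-frequency) for crux
`LatticeLandauDamping.AbelThermodynamicLimit` (stmt-AtomisticToContinuum-14013): the dyadic Fekete lemma with a
power allowance and the two-envelope squeeze

`--supports` file of the lead (`prover-line-stmt-AtomisticToContinuum-14013-0`), closing nothing; it proves the two
registered real-analysis stubs of the skeleton `Cruxes/AbelThermodynamicLimit/Lines/SketchIdeator2.lean` (rev 3) and
the helpers around them, so that the final skeleton landing imports them instead of carrying 300 lines of real analysis:

* `stub_dyadicFeketePow` (= `fekete_pow`) — **de Bruijn–Erdős–Fekete at a fixed Laplace frequency, doubling form, power allowance**: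
  `2·G N − C(2N)^θ ≤ G(2N)` for `N ≥ N₀ ≥ 1` (`θ < 1`, `C ≥ 0`) and `G N/N → g` give
  `G N ≤ N·g + C·(2^(θ−1)/(1−2^(θ−1)))·N^θ` for EVERY `N ≥ N₀` (dyadic tower; the geometric series converges since `θ < 1`);
* `fekete_pow_abel_upper` — the same passed to DC (`ν ↓ 0` at fixed `N`): `G0 N ≤ N·L + C'·N^θ`;
* `dc_of_resistance_bound` — resistance side at DC with positivity FORCED: `a/F(ν) ≤ b(ν)` on `(0,ν₀]`, `0 < F`,
  `F → F0 ≥ 0`, `b → b₀` give `0 < F0` and `a/F0 ≤ b₀`;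
* `stub_twoSignLawsTendsto` (= `two_sign_laws_tendsto'`) — the two envelopes with sub-linear allowances squeeze: `(N−1)/D_N ≤ N/κ + E N`,
  `(N−1)D_N ≤ Nκ + E' N`, `E N/N, E' N/N → 0`, `D_N > 0` (all for `N ≥ N₀ ≥ 2`) give `D_N → κ`;
* `tendsto_laplace_zero`, `tendsto_resistance_div`, `tendsto_const_mul_rpow_div`, `dyadic_const_pos` — small helpers.

Pure real analysis over Mathlib (no chain objects, no definitions, no named facts).
-/

noncomputable section

namespace Summit.AtomisticToContinuum.FouriersLaw.Theorems.AbelThermodynamicLimit.SeriesLawAtEveryLaplaceFrequency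

open MeasureTheory Filter Set Topology


/-- **Resistance side at DC, positivity forced.** Fix `N`. If `a > 0`, `0 < F ν` on `(0, ν₀]`, `F ν → F0 ≥ 0`
as `ν ↓ 0`, the resistance bound `a / F ν ≤ b ν` holds on `(0, ν₀]` and `b ν → b₀`, then `F0 > 0` (otherwise
`a / F ν → +∞`) and `a / F0 ≤ b₀`. -/
theorem dc_of_resistance_bound (F b : ℝ → ℝ) (a F0 b₀ ν₀ : ℝ) (ha : 0 < a) (hν₀ : 0 < ν₀)
    (hFpos : ∀ ν ∈ Ioc (0 : ℝ) ν₀, 0 < F ν) (hDC : Tendsto F (𝓝[>] 0) (𝓝 F0)) (hF0 : 0 ≤ F0)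
    (hkey : ∀ ν ∈ Ioc (0 : ℝ) ν₀, a / F ν ≤ b ν) (hb : Tendsto b (𝓝[>] 0) (𝓝 b₀)) :
    0 < F0 ∧ a / F0 ≤ b₀ := by
  have hbev : ∀ᶠ ν in 𝓝[>] (0 : ℝ), b ν < b₀ + 1 := hb.eventually (gt_mem_nhds (by linarith))
  have hpos : 0 < F0 := by
    rcases hF0.lt_or_eq with h | h
    · exact h
    · exfalso
      -- `F0 = 0`: `F ν → 0⁺`, so `a / F ν` exceeds `b₀ + 1` near `0`, contradicting the bound
      have hB : 0 < max (b₀ + 1) 1 := lt_of_lt_of_le one_pos (le_max_right _ _)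
      have hsmall : ∀ᶠ ν in 𝓝[>] (0 : ℝ), F ν < a / max (b₀ + 1) 1 := by
        have : Tendsto F (𝓝[>] 0) (𝓝 0) := h ▸ hDC
        exact this.eventually (gt_mem_nhds (by positivity))
      obtain ⟨ν, hνs, hνb, hνI⟩ := (hsmall.and (hbev.and (Ioc_mem_nhdsGT hν₀))).exists
      have hFν := hFpos ν hνI
      have h1 : max (b₀ + 1) 1 < a / F ν := by
        rw [lt_div_iff₀ hFν]
        have := (lt_div_iff₀ hB).1 hνs
        linarith [mul_comm (F ν) (max (b₀ + 1) 1)]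
      have h2 := hkey ν hνI
      have h3 : b₀ + 1 ≤ max (b₀ + 1) 1 := le_max_left _ _
      linarith
  refine ⟨hpos, ?_⟩
  have hlimR : Tendsto (fun ν => a / F ν) (𝓝[>] 0) (𝓝 (a / F0)) :=
    (tendsto_const_nhds.div hDC hpos.ne')
  have hev : ∀ᶠ ν in 𝓝[>] (0 : ℝ), a / F ν ≤ b ν := by
    filter_upwards [Ioc_mem_nhdsGT hν₀] with ν hν using hkey ν hν
  exact le_of_tendsto_of_tendsto hlimR hb hev

/-- The Laplace transform of an `L¹(0,∞)` function is right-continuous at `0` (dominated convergence). -/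
theorem tendsto_laplace_zero {c : ℝ → ℝ} (hc : IntegrableOn c (Ioi 0)) :
    Tendsto (fun ν : ℝ => ∫ t in Ioi (0 : ℝ), Real.exp (-(ν * t)) * c t) (𝓝[>] 0)
      (𝓝 (∫ t in Ioi (0 : ℝ), c t)) := by
  have key : Tendsto (fun ν : ℝ => ∫ t in Ioi (0 : ℝ), Real.exp (-(ν * t)) * c t) (𝓝[>] 0)
      (𝓝 (∫ t in Ioi (0 : ℝ), Real.exp (-(0 * t)) * c t)) := by
    apply tendsto_integral_filter_of_dominated_convergence (fun t => |c t|)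
    · refine Eventually.of_forall fun ν => ?_
      have hcont : Continuous fun t : ℝ => Real.exp (-(ν * t)) := by fun_prop
      exact hcont.aestronglyMeasurable.mul hc.aestronglyMeasurable
    · filter_upwards [self_mem_nhdsWithin] with ν hν
      refine (ae_restrict_mem measurableSet_Ioi).mono fun t ht => ?_
      have hν' : (0 : ℝ) < ν := hν
      have ht' : (0 : ℝ) < t := ht
      rw [Real.norm_eq_abs, abs_mul, Real.abs_exp]
      have hle : Real.exp (-(ν * t)) ≤ 1 := Real.exp_le_one_iff.mpr (by nlinarith)
      calc Real.exp (-(ν * t)) * |c t| ≤ 1 * |c t| := by gcongr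
        _ = |c t| := one_mul _
    · exact hc.abs
    · refine Eventually.of_forall fun t => ?_
      have hcont : Continuous fun ν : ℝ => Real.exp (-(ν * t)) * c t := by fun_prop
      exact (hcont.tendsto 0).mono_left nhdsWithin_le_nhds
  simpa using key

/-- Per-length limit of the resistance form from that of the conductance form:
if `F N / N → K ≠ 0` then `((N−1)²T²/F N)/N → T²/K`. -/
theorem tendsto_resistance_div (F : ℕ → ℝ) (T K : ℝ) (hK : K ≠ 0)
    (h : Tendsto (fun N : ℕ => F N / N) atTop (𝓝 K)) :
    Tendsto (fun N : ℕ => ((N : ℝ) - 1) ^ 2 * T ^ 2 / F N / N) atTop (𝓝 (T ^ 2 / K)) := by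
  have h1 : Tendsto (fun N : ℕ => ((N : ℝ) + (-1)) / (N : ℝ)) atTop (𝓝 1) := by
    have := tendsto_natCast_div_add_atTop (1 : ℝ)
    -- (N-1)/N = 1 - 1/N
    have h' : Tendsto (fun N : ℕ => (1 : ℝ) - 1 / (N : ℝ)) atTop (𝓝 (1 - 0)) :=
      tendsto_const_nhds.sub tendsto_one_div_atTop_nhds_zero_nat
    rw [sub_zero] at h'
    refine h'.congr' ?_
    filter_upwards [eventually_gt_atTop 0] with N hN
    have hN0 : (N : ℝ) ≠ 0 := by positivity
    field_simp
    ring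
  have h2 : Tendsto (fun N : ℕ => T ^ 2 * (((N : ℝ) + (-1)) / (N : ℝ)) ^ 2 * (F N / N)⁻¹) atTop
      (𝓝 (T ^ 2 * 1 ^ 2 * K⁻¹)) :=
    ((h1.pow 2).const_mul (T ^ 2)).mul (h.inv₀ hK)
  rw [one_pow, mul_one, ← div_eq_mul_inv] at h2
  refine h2.congr' ?_
  filter_upwards [eventually_gt_atTop 0] with N hN
  have hN0 : (N : ℝ) ≠ 0 := by positivity
  by_cases hF : F N = 0
  · simp [hF]
  · field_simp
    ring

/-- **de Bruijn–Erdős–Fekete at a fixed frequency, DOUBLING form with a power allowance**: if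
`2·G N − C (2N)^θ ≤ G (2N)` for `N ≥ N₀ ≥ 1` (`θ < 1`, `C ≥ 0`) and `G N / N → g`, then
`G N ≤ N g + C (2^(θ-1)/(1 - 2^(θ-1))) N^θ` for EVERY `N ≥ N₀` (dyadic tower `N, 2N, 4N, …`; the geometric
series `Σ 2^{j(θ-1)}` converges because `θ < 1`). With `θ = 0` this is plain Fekete with an `O(1)` allowance. -/
theorem fekete_pow (G : ℕ → ℝ) (g C θ : ℝ) (N₀ : ℕ) (hN₀ : 1 ≤ N₀) (hC : 0 ≤ C) (hθ : θ < 1)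
    (hQ : ∀ N : ℕ, N₀ ≤ N → 2 * G N - C * ((2 * N : ℕ) : ℝ) ^ θ ≤ G (2 * N))
    (hlim : Tendsto (fun N : ℕ => G N / N) atTop (𝓝 g)) :
    ∀ N : ℕ, N₀ ≤ N → G N ≤ N * g + C * ((2:ℝ) ^ (θ - 1) / (1 - (2:ℝ) ^ (θ - 1))) * (N : ℝ) ^ θ := by
  intro N hN
  set r : ℝ := (2:ℝ) ^ (θ - 1) with hr
  have hr0 : 0 < r := Real.rpow_pos_of_pos two_pos _
  have hr1 : r < 1 := Real.rpow_lt_one_of_one_lt_of_neg one_lt_two (by linarith)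
  have hNpos : 0 < N := by omega
  have hNR : (0:ℝ) < N := by exact_mod_cast hNpos
  have hNθ : 0 ≤ (N:ℝ) ^ θ := Real.rpow_nonneg hNR.le θ
  -- the allowance at dyadic level `j`: `C (2^j N)^θ = C N^θ 2^j r^j`
  have hall : ∀ j : ℕ, C * (((2 ^ j * N : ℕ) : ℝ)) ^ θ = C * (N:ℝ) ^ θ * (2:ℝ) ^ j * r ^ j := by
    intro j
    have h2j : (0:ℝ) ≤ (2:ℝ) ^ j := by positivity
    have e1 : (((2 ^ j * N : ℕ) : ℝ)) ^ θ = ((2:ℝ) ^ j) ^ θ * (N:ℝ) ^ θ := by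
      push_cast
      exact Real.mul_rpow h2j hNR.le
    have e2 : ((2:ℝ) ^ j) ^ θ = (2:ℝ) ^ j * r ^ j := by
      rw [hr, ← Real.rpow_natCast ((2:ℝ) ^ (θ - 1)) j, ← Real.rpow_mul (by norm_num : (0:ℝ) ≤ 2),
        ← Real.rpow_natCast (2:ℝ) j, ← Real.rpow_mul (by norm_num : (0:ℝ) ≤ 2),
        ← Real.rpow_add two_pos]
      congr 1
      ring
    rw [e1, e2]
    ring
  -- the dyadic iteration
  have iter : ∀ k : ℕ, (2:ℝ) ^ k * G N - C * (N:ℝ) ^ θ * (2:ℝ) ^ k * ∑ j ∈ Finset.range k, r ^ (j + 1)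
      ≤ G (2 ^ k * N) := by
    intro k
    induction k with
    | zero => simp
    | succ k ih =>
      have h2k : N₀ ≤ 2 ^ k * N := le_trans hN (Nat.le_mul_of_pos_left N (Nat.two_pow_pos k))
      have hq := hQ (2 ^ k * N) h2k
      have hidx : 2 * (2 ^ k * N) = 2 ^ (k + 1) * N := by ring
      rw [hidx, hall (k + 1)] at hq
      rw [Finset.sum_range_succ, pow_succ]
      have e : (2:ℝ) ^ k * 2 * G N - C * (N:ℝ) ^ θ * ((2:ℝ) ^ k * 2) *
            (∑ j ∈ Finset.range k, r ^ (j + 1) + r ^ (k + 1)) =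
          2 * ((2:ℝ) ^ k * G N - C * (N:ℝ) ^ θ * (2:ℝ) ^ k * ∑ j ∈ Finset.range k, r ^ (j + 1)) -
            C * (N:ℝ) ^ θ * (2:ℝ) ^ (k + 1) * r ^ (k + 1) := by
        rw [pow_succ]; ring
      rw [e]
      linarith [ih, hq]
  -- geometric partial sums are bounded by `r/(1-r)`
  have hgeom : ∀ k : ℕ, ∑ j ∈ Finset.range k, r ^ (j + 1) ≤ r / (1 - r) := by
    intro k
    have h1 : ∑ j ∈ Finset.range k, r ^ (j + 1) = r * ∑ j ∈ Finset.range k, r ^ j := by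
      rw [Finset.mul_sum]
      refine Finset.sum_congr rfl fun j _ => ?_
      rw [pow_succ]; ring
    rw [h1, geom_sum_eq hr1.ne k, le_div_iff₀ (by linarith)]
    have : r * ((r ^ k - 1) / (r - 1)) * (1 - r) = r * (1 - r ^ k) := by
      have : r - 1 ≠ 0 := by linarith
      field_simp
      ring
    rw [this]
    have hrk : 0 ≤ r ^ k := pow_nonneg hr0.le k
    nlinarith
  -- pass to the limit `k → ∞` in `G N ≤ N · (G(2^k N)/(2^k N)) + C N^θ r/(1-r)`
  have hbound : ∀ k : ℕ, G N ≤ (N:ℝ) * (G (2 ^ k * N) / ((2 ^ k * N : ℕ) : ℝ)) + C * (r / (1 - r)) * (N:ℝ) ^ θ := by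
    intro k
    have h2k : (0:ℝ) < (2:ℝ) ^ k := by positivity
    have hi := iter k
    have hg := hgeom k
    have hcast : ((2 ^ k * N : ℕ) : ℝ) = (2:ℝ) ^ k * N := by push_cast; ring
    rw [hcast]
    have e : (N:ℝ) * (G (2 ^ k * N) / ((2:ℝ) ^ k * N)) = G (2 ^ k * N) / (2:ℝ) ^ k := by
      field_simp
    rw [e, div_eq_mul_inv]
    have hS : C * (N:ℝ) ^ θ * (2:ℝ) ^ k * ∑ j ∈ Finset.range k, r ^ (j + 1) ≤
        C * (N:ℝ) ^ θ * (2:ℝ) ^ k * (r / (1 - r)) :=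
      mul_le_mul_of_nonneg_left hg (by positivity)
    have h3 : (2:ℝ) ^ k * G N ≤ G (2 ^ k * N) + C * (N:ℝ) ^ θ * (2:ℝ) ^ k * (r / (1 - r)) := by linarith
    have h4 : G N ≤ (G (2 ^ k * N) + C * (N:ℝ) ^ θ * (2:ℝ) ^ k * (r / (1 - r))) * ((2:ℝ) ^ k)⁻¹ := by
      rw [le_mul_inv_iff₀ h2k]
      linarith
    have e2 : (G (2 ^ k * N) + C * (N:ℝ) ^ θ * (2:ℝ) ^ k * (r / (1 - r))) * ((2:ℝ) ^ k)⁻¹ =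
        G (2 ^ k * N) * ((2:ℝ) ^ k)⁻¹ + C * (r / (1 - r)) * (N:ℝ) ^ θ := by
      field_simp
    linarith [h4, e2.le, e2.ge]
  have hmul : Tendsto (fun k : ℕ => 2 ^ k * N) atTop atTop := by
    refine tendsto_atTop_atTop.2 fun b => ⟨b, fun k hk => le_trans hk ?_⟩
    exact le_trans (Nat.lt_two_pow_self).le (Nat.le_mul_of_pos_right _ hNpos)
  have hsub : Tendsto (fun k : ℕ => G (2 ^ k * N) / ((2 ^ k * N : ℕ) : ℝ)) atTop (𝓝 g) := hlim.comp hmul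
  have hT : Tendsto (fun k : ℕ => (N:ℝ) * (G (2 ^ k * N) / ((2 ^ k * N : ℕ) : ℝ)) + C * (r / (1 - r)) * (N:ℝ) ^ θ)
      atTop (𝓝 ((N:ℝ) * g + C * (r / (1 - r)) * (N:ℝ) ^ θ)) :=
    (hsub.const_mul (N:ℝ)).add_const _
  exact ge_of_tendsto hT (Eventually.of_forall hbound)


/-- Lower envelope with a sublinear allowance: `(N−1)/D_N ≤ N/κ + E N`, `D_N > 0`, `κ > 0`, `E ≥ 0` give
`κ (N−1)/(N + κ E N) ≤ D_N`. -/
theorem conductance_lower_of_resistance' (D E : ℕ → ℝ) (κ : ℝ) (N₀ : ℕ) (hN₀ : 2 ≤ N₀) (hκ : 0 < κ)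
    (hE : ∀ N, 0 ≤ E N)
    (hpos : ∀ N : ℕ, N₀ ≤ N → 0 < D N)
    (hR : ∀ N : ℕ, N₀ ≤ N → ((N : ℝ) - 1) / D N ≤ N * κ⁻¹ + E N) :
    ∀ N : ℕ, N₀ ≤ N → κ * (((N : ℝ) - 1) / ((N : ℝ) + κ * E N)) ≤ D N := by
  intro N hN
  have hD := hpos N hN
  have hNR : (2 : ℝ) ≤ N := by exact_mod_cast (le_trans hN₀ hN)
  have hEN := hE N
  have hden : 0 < (N : ℝ) + κ * E N := by positivity
  have h := hR N hN
  rw [div_le_iff₀ hD] at h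
  have h2 : κ * ((N : ℝ) - 1) ≤ ((N : ℝ) + κ * E N) * D N := by
    have := mul_le_mul_of_nonneg_left h hκ.le
    have e : κ * ((N : ℝ) * κ⁻¹ + E N) = (N : ℝ) + κ * E N := by field_simp
    calc κ * ((N : ℝ) - 1) ≤ κ * (((N : ℝ) * κ⁻¹ + E N) * D N) := this
      _ = ((N : ℝ) + κ * E N) * D N := by rw [← mul_assoc, e]
  rw [mul_div_assoc', div_le_iff₀ hden]
  linarith [mul_comm ((N : ℝ) + κ * E N) (D N)]

/-- The lower envelope tends to `κ` when the allowance is sublinear. -/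
theorem tendsto_lower_envelope' (κ : ℝ) (E : ℕ → ℝ) (hE : Tendsto (fun N : ℕ => E N / N) atTop (𝓝 0)) :
    Tendsto (fun N : ℕ => κ * (((N : ℝ) - 1) / ((N : ℝ) + κ * E N))) atTop (𝓝 κ) := by
  -- (N-1)/(N + κ E N) = (1 - 1/N) / (1 + κ E N / N) → 1
  have h1 : Tendsto (fun N : ℕ => (1 : ℝ) - 1 / (N : ℝ)) atTop (𝓝 (1 - 0)) :=
    tendsto_const_nhds.sub tendsto_one_div_atTop_nhds_zero_nat
  have h2 : Tendsto (fun N : ℕ => (1 : ℝ) + κ * (E N / N)) atTop (𝓝 (1 + κ * 0)) :=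
    tendsto_const_nhds.add (hE.const_mul κ)
  rw [sub_zero] at h1
  rw [mul_zero, add_zero] at h2
  have h3 := (h1.div h2 one_ne_zero).const_mul κ
  rw [div_one, mul_one] at h3
  refine h3.congr' ?_
  have hev : ∀ᶠ N : ℕ in atTop, (0 : ℝ) < 1 + κ * (E N / N) :=
    h2.eventually (lt_mem_nhds one_pos)
  filter_upwards [eventually_gt_atTop 0, hev] with N hN hpos
  simp only [Pi.div_apply]
  have hNR : (0 : ℝ) < N := by exact_mod_cast hN
  have e1 : (1 : ℝ) - 1 / (N : ℝ) = ((N : ℝ) - 1) / N := by field_simp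
  have e2 : (1 : ℝ) + κ * (E N / N) = ((N : ℝ) + κ * E N) / N := by field_simp
  rw [e1, e2, div_div_div_cancel_right₀ hNR.ne']

/-- The upper envelope `(Nκ + E' N)/(N−1)` tends to `κ` when the allowance is sublinear. -/
theorem tendsto_upper_envelope' (κ : ℝ) (E : ℕ → ℝ) (hE : Tendsto (fun N : ℕ => E N / N) atTop (𝓝 0)) :
    Tendsto (fun N : ℕ => ((N : ℝ) * κ + E N) / ((N : ℝ) - 1)) atTop (𝓝 κ) := by
  have h1 : Tendsto (fun N : ℕ => (1 : ℝ) - 1 / (N : ℝ)) atTop (𝓝 (1 - 0)) :=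
    tendsto_const_nhds.sub tendsto_one_div_atTop_nhds_zero_nat
  have h2 : Tendsto (fun N : ℕ => κ + E N / N) atTop (𝓝 (κ + 0)) := tendsto_const_nhds.add hE
  rw [sub_zero] at h1
  rw [add_zero] at h2
  have h3 := h2.div h1 one_ne_zero
  rw [div_one] at h3
  refine h3.congr' ?_
  filter_upwards [eventually_gt_atTop 1] with N hN
  simp only [Pi.div_apply]
  have hNR : (1 : ℝ) < N := by exact_mod_cast hN
  have hN0 : (N : ℝ) ≠ 0 := by positivity
  have hN1 : (N : ℝ) - 1 ≠ 0 := by linarith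
  have e1 : κ + E N / N = ((N : ℝ) * κ + E N) / N := by field_simp
  have e2 : (1 : ℝ) - 1 / (N : ℝ) = ((N : ℝ) - 1) / N := by field_simp
  rw [e1, e2, div_div_div_cancel_right₀ hN0]

/-- **Two sign laws with sublinear allowances close the crux.** -/
theorem two_sign_laws_tendsto' (D E E' : ℕ → ℝ) (κ : ℝ) (N₀ : ℕ) (hN₀ : 2 ≤ N₀) (hκ : 0 < κ)
    (hE0 : ∀ N, 0 ≤ E N)
    (hE : Tendsto (fun N : ℕ => E N / N) atTop (𝓝 0)) (hE' : Tendsto (fun N : ℕ => E' N / N) atTop (𝓝 0))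
    (hpos : ∀ N : ℕ, N₀ ≤ N → 0 < D N)
    (hlow : ∀ N : ℕ, N₀ ≤ N → ((N : ℝ) - 1) / D N ≤ N * κ⁻¹ + E N)
    (hup : ∀ N : ℕ, N₀ ≤ N → ((N : ℝ) - 1) * D N ≤ N * κ + E' N) :
    Tendsto D atTop (𝓝 κ) := by
  have hlo := conductance_lower_of_resistance' D E κ N₀ hN₀ hκ hE0 hpos hlow
  refine tendsto_of_tendsto_of_tendsto_of_le_of_le' (tendsto_lower_envelope' κ E hE)
    (tendsto_upper_envelope' κ E' hE') ?_ ?_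
  · filter_upwards [eventually_ge_atTop N₀] with N hN using hlo N hN
  · filter_upwards [eventually_ge_atTop N₀] with N hN
    have hNR : (2 : ℝ) ≤ N := by exact_mod_cast (le_trans hN₀ hN)
    have hpos' : (0 : ℝ) < (N : ℝ) - 1 := by linarith
    rw [le_div_iff₀ hpos', mul_comm]
    exact hup N hN

/-- `C N^θ / N → 0` for `θ < 1`. -/
theorem tendsto_const_mul_rpow_div (C θ : ℝ) (hθ : θ < 1) :
    Tendsto (fun N : ℕ => C * (N : ℝ) ^ θ / N) atTop (𝓝 0) := by
  have h : Tendsto (fun x : ℝ => x ^ (θ - 1)) atTop (𝓝 0) := by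
    have := tendsto_rpow_neg_atTop (show 0 < 1 - θ by linarith)
    refine this.congr' (Eventually.of_forall fun x => ?_)
    simp only [neg_sub]
  have h2 := (h.comp tendsto_natCast_atTop_atTop).const_mul C
  rw [mul_zero] at h2
  refine h2.congr' ?_
  filter_upwards [eventually_gt_atTop 0] with N hN
  have hNR : (0 : ℝ) < N := by exact_mod_cast hN
  simp only [Function.comp]
  rw [Real.rpow_sub_one hNR.ne', mul_div_assoc]


/-- **Fekete (doubling, power allowance) ⇒ upper half at DC**: with `G N ν → G0 N` (`ν ↓ 0`) and `g ν → L`,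
`G0 N ≤ N·L + C' N^θ` for every `N ≥ N₀`. -/
theorem fekete_pow_abel_upper (G : ℕ → ℝ → ℝ) (G0 : ℕ → ℝ) (g : ℝ → ℝ) (C θ L ν₀ : ℝ) (N₀ : ℕ)
    (hN₀ : 1 ≤ N₀) (hC : 0 ≤ C) (hθ : θ < 1) (hν₀ : 0 < ν₀)
    (hQ : ∀ ν ∈ Ioc (0 : ℝ) ν₀, ∀ N : ℕ, N₀ ≤ N → 2 * G N ν - C * ((2 * N : ℕ) : ℝ) ^ θ ≤ G (2 * N) ν)
    (hlim : ∀ ν ∈ Ioc (0 : ℝ) ν₀, Tendsto (fun N : ℕ => G N ν / N) atTop (𝓝 (g ν)))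
    (hg : Tendsto g (𝓝[>] 0) (𝓝 L))
    (hDC : ∀ N : ℕ, N₀ ≤ N → Tendsto (G N) (𝓝[>] 0) (𝓝 (G0 N))) :
    ∀ N : ℕ, N₀ ≤ N → G0 N ≤ N * L + C * ((2:ℝ) ^ (θ - 1) / (1 - (2:ℝ) ^ (θ - 1))) * (N : ℝ) ^ θ := by
  intro N hN
  have key : ∀ ν ∈ Ioc (0 : ℝ) ν₀,
      G N ν ≤ N * g ν + C * ((2:ℝ) ^ (θ - 1) / (1 - (2:ℝ) ^ (θ - 1))) * (N : ℝ) ^ θ :=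
    fun ν hν => fekete_pow (fun M => G M ν) (g ν) C θ N₀ hN₀ hC hθ (fun M hM => hQ ν hν M hM) (hlim ν hν) N hN
  have hev : ∀ᶠ ν in 𝓝[>] (0 : ℝ),
      G N ν ≤ N * g ν + C * ((2:ℝ) ^ (θ - 1) / (1 - (2:ℝ) ^ (θ - 1))) * (N : ℝ) ^ θ := by
    filter_upwards [Ioc_mem_nhdsGT hν₀] with ν hν using key ν hν
  have hlimG : Tendsto (fun ν => (N : ℝ) * g ν + C * ((2:ℝ) ^ (θ - 1) / (1 - (2:ℝ) ^ (θ - 1))) * (N : ℝ) ^ θ)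
      (𝓝[>] (0 : ℝ)) (𝓝 (N * L + C * ((2:ℝ) ^ (θ - 1) / (1 - (2:ℝ) ^ (θ - 1))) * (N : ℝ) ^ θ)) :=
    (hg.const_mul (N : ℝ)).add_const _
  exact le_of_tendsto_of_tendsto (hDC N hN) hlimG hev

/-- The dyadic constant `2^(θ-1)/(1-2^(θ-1))` is positive for `θ < 1`. -/
theorem dyadic_const_pos {θ : ℝ} (hθ : θ < 1) : 0 < (2:ℝ) ^ (θ - 1) / (1 - (2:ℝ) ^ (θ - 1)) := by
  have hr0 : 0 < (2:ℝ) ^ (θ - 1) := Real.rpow_pos_of_pos two_pos _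
  have hr1 : (2:ℝ) ^ (θ - 1) < 1 := Real.rpow_lt_one_of_one_lt_of_neg one_lt_two (by linarith)
  exact div_pos hr0 (by linarith)


/-! ## The two registered stubs, stated VERBATIM (binder-free form) -/

/-- **Registered stub `stub_dyadicFeketePow`** (verbatim signature): de Bruijn–Erdős–Fekete at a fixed Laplace
frequency, doubling form with a power allowance — see `fekete_pow`. -/
theorem stub_dyadicFeketePow : ∀ (G : ℕ → ℝ) (g C θ : ℝ) (N₀ : ℕ), 1 ≤ N₀ → 0 ≤ C → θ < 1 → (∀ N : ℕ, N₀ ≤ N → 2 * G N - C * ((2 * N : ℕ) : ℝ) ^ θ ≤ G (2 * N)) → Filter.Tendsto (fun N : ℕ => G N / N) Filter.atTop (nhds g) → ∀ N : ℕ, N₀ ≤ N → G N ≤ N * g + C * ((2:ℝ) ^ (θ - 1) / (1 - (2:ℝ) ^ (θ - 1))) * (N : ℝ) ^ θ :=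
  fun G g C θ N₀ hN₀ hC hθ hQ hlim => fekete_pow G g C θ N₀ hN₀ hC hθ hQ hlim

/-- **Registered stub `stub_twoSignLawsTendsto`** (verbatim signature): the two envelopes with sub-linear
allowances squeeze `D_N → κ` — see `two_sign_laws_tendsto'`. -/
theorem stub_twoSignLawsTendsto : ∀ (D E E' : ℕ → ℝ) (κ : ℝ) (N₀ : ℕ), 2 ≤ N₀ → 0 < κ → (∀ N, 0 ≤ E N) → Filter.Tendsto (fun N : ℕ => E N / N) Filter.atTop (nhds 0) → Filter.Tendsto (fun N : ℕ => E' N / N) Filter.atTop (nhds 0) → (∀ N : ℕ, N₀ ≤ N → 0 < D N) → (∀ N : ℕ, N₀ ≤ N → ((N : ℝ) - 1) / D N ≤ N * κ⁻¹ + E N) → (∀ N : ℕ, N₀ ≤ N → ((N : ℝ) - 1) * D N ≤ N * κ + E' N) → Filter.Tendsto D Filter.atTop (nhds κ) :=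
  fun D E E' κ N₀ hN₀ hκ hE0 hE hE' hpos hlow hup => two_sign_laws_tendsto' D E E' κ N₀ hN₀ hκ hE0 hE hE' hpos hlow hup

end Summit.AtomisticToContinuum.FouriersLaw.Theorems.AbelThermodynamicLimit.SeriesLawAtEveryLaplaceFrequency

end
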